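import Literature.MathematicalPhysics.QuantumFieldTheory.Balaban1983to89.B9Eq349ConjugatedProjection

/-!
# `Balaban1983to89.B9Eq349ConjugatedProjectionDifferenceSqrtKappa` — T. Bałaban, *Propagators for lattice gauge theories in a background field*, Commun.
# Math. Phys. **99** (1985) 389–434 [Balaban1985BackgroundPropagators] (3.21)∕(3.25) p. 394, (3.49) p. 399, Thm 3.2 (3.48) p. 398, Thm 3.11 p. 416: **THE
# DIFFERENCE OF THE CONJUGATED PROJECTION — `‖S P S⁻¹ x − P x‖ ≤ ((6δ₊ + 9δ₋)∕√κ₁)·‖x‖` and, for `R = 1 − P`, `‖S R S⁻¹ x − R x‖ ≤` the same —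
# IN THE LETTERS OF `B9Eq349ConjugatedProjection.norm_conjProj_le_two` VERBATIM (no new letter)**: the TREE's own two-projection device (`projM_conj`,
# `projN_conj`, `norm_proj_sub_proj_le_anchored`) prices the letter `ρ` of `B9Eq326ConjugatedDeltaALetters` (`dR`) at `κ₁^{−1∕2}` with NO difference of
# `c = (Q̃′G′²Q̃′†)⁻¹` and NO `T`-letter — the located remark L-g141-2′ of the NE9 crux-ideation seat t4-ne9-idea-1 (gen 141; Mathlib-side SCRATCH
# `t4/ideate/NE9/lens1-NE9ConjProjDiffSqrtKappa.lean` 81d8ed09e72a403b, kernel-checked, never proposed under FREEZE (0) — CREDIT: statements and proofs are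
# theirs; this file is the def-free Literature PORT by the NE9 formalisation swarm, as `B9Eq349ConjugatedGreenLetters` ported their gen-84 kernel)

statement-level skeleton of published theorems with citation tags; proofs where landed; nothing here is a claim about the Yang–Mills mass gap

CITATION HEADER (lean-in-tree rule).  Audit cell `pub-balaban`, sub-cell `t4`, BINDER row NE9; filed by NE9 formalisation-swarm leaf prover 03
(`b2b-balaban-t4-ne9-formalise-leaf-03`, gen 75) for t4-ne9-idea-1 g141 (W-g141-2 A-2, journal 2026-08-24T17:24:55Z).  Imports ne9-leaf-06's
`B9Eq349ConjugatedProjection` (t4-ne9-idea-1 gen 89's kernel 3: `norm_conjProj_le_two`, `projM_conj`, `projN_conj`, `norm_proj_sub_proj_le_anchored`) only.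
Sources READ first-hand: [Balaban1985BackgroundPropagators] p. 394 (3.21) *«R … the orthogonal projection onto Δ^η_U N(Q′)»*, (3.25); p. 399 (3.49) (print's
kernels of `P = I − R`, by the random walk — NOT asserted); p. 398 Thm 3.2 (3.48); p. 416 Thm 3.11 (the source of `κ₁`).  The conjugation is the ROUTE's
Combes–Thomas substitute; nothing of print's is asserted.

WHY THIS FILE (cell context).  `B9Eq326ConjugatedDeltaALetters.coercive_k_projected` (ne9-leaf-03 g75, road ΔA-CT: Combes–Thomas on `Δ_a` with the projected
square `D_UR(U)D*_U`) takes the letter `‖R_κ − R‖ ≤ ρ ≤ 1∕8`.  Two suppliers were typed the same day: `B9Eq349ConjugatedProjectionDifferenceLetters` (the word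
`A_κT_κ − AT`, `ρ ∝ β∕κ₁²`) and THIS one (`ρ = (6δ₊ + 9δ₋)∕√κ₁`, `δ± = β·s_A` by `B9Eq349ConjugatedDPChain.norm_Ap_sub_A_le` ∕ `norm_Am_sub_A_le`), whose
chain instance is the discharge pattern of `B9Eq349ConjugatedDPChain.norm_conjProj_chain_le_two` verbatim.

WHAT IS PROVED (sorry-free; proof lane — no `def`; [folklore] Hilbert-space algebra).  Letters as in `B9Eq349ConjugatedProjection.norm_conjProj_le_two`.
* **`norm_conjProj_sub_proj_le`** — `‖S(P(S⁻¹x)) − Px‖ ≤ ((6δ₊ + 9δ₋)∕√κ₁)‖x‖`.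
* **`norm_conjCompl_sub_compl_le`** — for `R x = x − P x`: `‖S(R(S⁻¹x)) − Rx‖ ≤ ((6δ₊ + 9δ₋)∕√κ₁)‖x‖`.
* `rho_le_eighth` — `120δ± ≤ √κ₁ ⟹ (6δ₊ + 9δ₋)∕√κ₁ ≤ 1∕8`.
HONEST SCOPE.  Abstract; `κ₁`, `δ±` displayed; no number; not instantiated here (next file); NOT NE9 (cell pub-balaban: NE9 NOT PRINTED ∕ NOT PROVED; «NE9 ⇐
the named binders»; row WALLED ON A MODEL (O-NE9-1; #5 UNRULED); spine PROVED 0∕9; rung (B)+1 on a finite T⁴ — NOT infinite volume, NOT mass gap, NOT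
BetaPertH, NOT Clay; HONEST DEPENDENCY: continuum YM on T⁴ ⇐ BetaPertH ∧ nine spine estimates (0/9 proved); BetaPertH ⇐ (D1) ∧ (D4) ∧ CAP+tail).  NEW file;
nothing modified.  Net new unproved facts: 0.
-/

namespace Literature.MathematicalPhysics.QuantumFieldTheory.Balaban1983to89.B9Eq349ConjugatedProjectionDifferenceSqrtKappa

open scoped InnerProductSpace
open B9Eq349ConjugatedProjection (norm_conjProj_le_two projM_conj projN_conj norm_proj_sub_proj_le_anchored)

variable {𝕜 : Type*} [RCLike 𝕜] {E : Type*} [NormedAddCommGroup E] [InnerProductSpace 𝕜 E]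
  {G : Type*} [NormedAddCommGroup G] [Module 𝕜 G]

variable {A Ap Am : G →ₗ[𝕜] E} {P PM PN S Sinv Sd : E →ₗ[𝕜] E} {T Tp Tm : E → G} {V W' : G → G}

/-- **THE CONJUGATED PROJECTION DIFFERS FROM THE PROJECTION BY `O((δ₊ + δ₋)∕√κ₁)`**: `‖S P S⁻¹ x − P x‖ ≤ ((6δ₊ + 9δ₋)∕√κ₁)‖x‖` — letters
verbatim those of `B9Eq349ConjugatedProjection.norm_conjProj_le_two`; `Πx − Px = (P_M(Πx) − P_N(Πx)) + (P_Nx − Px)` by `projM_conj` ∕ `projN_conj`, the anchored gap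
lemma twice, `‖Πx‖ ≤ 2‖x‖`. [folklore] (t4-ne9-idea-1 g141 kernel C) [cite: Balaban1985BackgroundPropagators, (3.21) p.394, (3.25) p.394, (3.49) p.399, Thm 3.2 (3.48) p.398] -/
theorem norm_conjProj_sub_proj_le (hPA : ∀ x, P x = A (T x)) (hfix : ∀ g, P (A g) = A g)
    (hsa : ∀ x y, ⟪P x, y⟫_𝕜 = ⟪x, P y⟫_𝕜)
    {κ₁ : ℝ} (hκ₁0 : 0 < κ₁) (hκ₁ : ∀ g, κ₁ * ‖g‖ ^ 2 ≤ ‖A g‖ ^ 2)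
    (hSS : ∀ x, S (Sinv x) = x) (hdual : ∀ x y, ⟪Sd x, S y⟫_𝕜 = ⟪x, y⟫_𝕜)
    (hV : ∀ g, S (A g) = Ap (V g)) (hPAp : ∀ x, PM x = Ap (Tp x)) (hfixp : ∀ g, PM (Ap g) = Ap g)
    (hsap : ∀ x y, ⟪PM x, y⟫_𝕜 = ⟪x, PM y⟫_𝕜)
    {δp : ℝ} (hδp0 : 0 ≤ δp) (hδp : ∀ h, ‖Ap h - A h‖ ≤ δp * ‖h‖) (hwp : 12 * δp ≤ Real.sqrt κ₁)
    (hAm : ∀ h, Am h = Sd (A (W' h))) (hPAm : ∀ x, PN x = Am (Tm x)) (hfixm : ∀ g, PN (Am g) = Am g)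
    (hsam : ∀ x y, ⟪PN x, y⟫_𝕜 = ⟪x, PN y⟫_𝕜)
    {δm : ℝ} (hδm0 : 0 ≤ δm) (hδm : ∀ h, ‖Am h - A h‖ ≤ δm * ‖h‖) (hwm : 12 * δm ≤ Real.sqrt κ₁) (x : E) :
    ‖S (P (Sinv x)) - P x‖ ≤ (6 * δp + 9 * δm) / Real.sqrt κ₁ * ‖x‖ := by
  have hs : 0 < Real.sqrt κ₁ := Real.sqrt_pos.mpr hκ₁0
  have hM : PM (S (P (Sinv x))) = S (P (Sinv x)) := projM_conj hPA hV hfixp x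
  have hN : PN (S (P (Sinv x))) = PN x := projN_conj hfix hsa hPAm hfixm hsam hAm hdual hSS x
  have e : S (P (Sinv x)) - P x = (PM (S (P (Sinv x))) - PN (S (P (Sinv x)))) + (PN x - P x) := by
    rw [hM, hN]; abel
  have h2 : ‖S (P (Sinv x))‖ ≤ 2 * ‖x‖ :=
    norm_conjProj_le_two hPA hfix hsa hκ₁0 hκ₁ hSS hdual hV hPAp hfixp hsap hδp0 hδp hwp hAm hPAm hfixm hsam
      hδm0 hδm hwm x
  have hθ : ∀ v, ‖PM v - PN v‖ ≤ 3 * (δp + δm) / Real.sqrt κ₁ * ‖v‖ := by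
    intro v
    have h1 : ‖PM v - P v‖ ≤ 3 * δp / Real.sqrt κ₁ * ‖v‖ :=
      norm_proj_sub_proj_le_anchored hPAp hfixp hsap hPA hfix hsa hκ₁0 hκ₁ hδp0 hδp (by linarith) v
    have h1' : ‖PN v - P v‖ ≤ 3 * δm / Real.sqrt κ₁ * ‖v‖ :=
      norm_proj_sub_proj_le_anchored hPAm hfixm hsam hPA hfix hsa hκ₁0 hκ₁ hδm0 hδm (by linarith) v
    calc ‖PM v - PN v‖ = ‖(PM v - P v) - (PN v - P v)‖ := by rw [sub_sub_sub_cancel_right]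
      _ ≤ ‖PM v - P v‖ + ‖PN v - P v‖ := norm_sub_le _ _
      _ ≤ 3 * δp / Real.sqrt κ₁ * ‖v‖ + 3 * δm / Real.sqrt κ₁ * ‖v‖ := add_le_add h1 h1'
      _ = 3 * (δp + δm) / Real.sqrt κ₁ * ‖v‖ := by ring
  have h3 : ‖PN x - P x‖ ≤ 3 * δm / Real.sqrt κ₁ * ‖x‖ :=
    norm_proj_sub_proj_le_anchored hPAm hfixm hsam hPA hfix hsa hκ₁0 hκ₁ hδm0 hδm (by linarith) x
  have hθ0 : 0 ≤ 3 * (δp + δm) / Real.sqrt κ₁ := by positivity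
  calc ‖S (P (Sinv x)) - P x‖ = ‖(PM (S (P (Sinv x))) - PN (S (P (Sinv x)))) + (PN x - P x)‖ := by rw [← e]
    _ ≤ ‖PM (S (P (Sinv x))) - PN (S (P (Sinv x)))‖ + ‖PN x - P x‖ := norm_add_le _ _
    _ ≤ 3 * (δp + δm) / Real.sqrt κ₁ * ‖S (P (Sinv x))‖ + 3 * δm / Real.sqrt κ₁ * ‖x‖ :=
        add_le_add (hθ _) h3
    _ ≤ 3 * (δp + δm) / Real.sqrt κ₁ * (2 * ‖x‖) + 3 * δm / Real.sqrt κ₁ * ‖x‖ :=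
        add_le_add (mul_le_mul_of_nonneg_left h2 hθ0) le_rfl
    _ = (6 * δp + 9 * δm) / Real.sqrt κ₁ * ‖x‖ := by ring

/-- **THE LETTER `dR` OF `B9Eq326ConjugatedDeltaALetters`**: for the complementary projection `R = 1 − P` (print's `R(U)`, (3.21)) and `SS⁻¹ = 1`,
`‖S R S⁻¹ x − R x‖ = ‖S P S⁻¹ x − P x‖ ≤ ((6δ₊ + 9δ₋)∕√κ₁)‖x‖`. [folklore] (t4-ne9-idea-1 g141 kernel C) [cite: Balaban1985BackgroundPropagators, (3.21) p.394, (3.25) p.394, (3.49) p.399] -/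
theorem norm_conjCompl_sub_compl_le {R : E →ₗ[𝕜] E} (hR : ∀ x, R x = x - P x)
    (hPA : ∀ x, P x = A (T x)) (hfix : ∀ g, P (A g) = A g)
    (hsa : ∀ x y, ⟪P x, y⟫_𝕜 = ⟪x, P y⟫_𝕜)
    {κ₁ : ℝ} (hκ₁0 : 0 < κ₁) (hκ₁ : ∀ g, κ₁ * ‖g‖ ^ 2 ≤ ‖A g‖ ^ 2)
    (hSS : ∀ x, S (Sinv x) = x) (hdual : ∀ x y, ⟪Sd x, S y⟫_𝕜 = ⟪x, y⟫_𝕜)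
    (hV : ∀ g, S (A g) = Ap (V g)) (hPAp : ∀ x, PM x = Ap (Tp x)) (hfixp : ∀ g, PM (Ap g) = Ap g)
    (hsap : ∀ x y, ⟪PM x, y⟫_𝕜 = ⟪x, PM y⟫_𝕜)
    {δp : ℝ} (hδp0 : 0 ≤ δp) (hδp : ∀ h, ‖Ap h - A h‖ ≤ δp * ‖h‖) (hwp : 12 * δp ≤ Real.sqrt κ₁)
    (hAm : ∀ h, Am h = Sd (A (W' h))) (hPAm : ∀ x, PN x = Am (Tm x)) (hfixm : ∀ g, PN (Am g) = Am g)
    (hsam : ∀ x y, ⟪PN x, y⟫_𝕜 = ⟪x, PN y⟫_𝕜)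
    {δm : ℝ} (hδm0 : 0 ≤ δm) (hδm : ∀ h, ‖Am h - A h‖ ≤ δm * ‖h‖) (hwm : 12 * δm ≤ Real.sqrt κ₁) (x : E) :
    ‖S (R (Sinv x)) - R x‖ ≤ (6 * δp + 9 * δm) / Real.sqrt κ₁ * ‖x‖ := by
  have e : S (R (Sinv x)) - R x = -(S (P (Sinv x)) - P x) := by
    rw [hR, hR, map_sub, hSS]; abel
  rw [e, norm_neg]
  exact norm_conjProj_sub_proj_le hPA hfix hsa hκ₁0 hκ₁ hSS hdual hV hPAp hfixp hsap hδp0 hδp hwp hAm hPAm hfixm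
    hsam hδm0 hδm hwm x

/-- **WINDOW FORM**: `120δ± ≤ √κ₁` (a Combes–Thomas radius `∝ √κ₁`, ten times inside the size window `12δ± ≤ √κ₁`) gives `ρ ≤ 1∕8`, the window of
`B9Eq326ConjugatedDeltaALetters.coercive_k_projected`. [folklore] [cite: Balaban1985BackgroundPropagators, (3.49) p.399] -/
theorem rho_le_eighth {δp δm κ₁ : ℝ} (hκ₁0 : 0 < κ₁) (hp : 120 * δp ≤ Real.sqrt κ₁)
    (hm : 120 * δm ≤ Real.sqrt κ₁) : (6 * δp + 9 * δm) / Real.sqrt κ₁ ≤ 1 / 8 := by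
  have hs : 0 < Real.sqrt κ₁ := Real.sqrt_pos.mpr hκ₁0
  rw [div_le_iff₀ hs]; nlinarith

end Literature.MathematicalPhysics.QuantumFieldTheory.Balaban1983to89.B9Eq349ConjugatedProjectionDifferenceSqrtKappa
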